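import Summits.Ventures.DiscreteObjects.Hadamard.SymmetricTMatrices668

/-!
# Hadamard 668 census — no circulant T-matrices of order 167 invariant under the quadratic-residue multipliers (kernel)

Framing: lottery ticket; floor = certified bounds/negative ranges.

Cell pub-namedobj (venture DiscreteObjects), target (H).  Companion of `SymmetricTMatrices668.lean`.  At the prime
`167` the multiplier group `(ℤ/167)ˣ ≅ C₁₆₆` has exactly two proper non-trivial subgroups: `{±1}` (index-83 cyclotomy;
T-matrix rows invariant under it are the SYMMETRIC ones, excluded there) and the squares `Q = ⟨4⟩` of order `83`
(index-2 cyclotomy, the Paley / QR-type structure).  First rows `t_k : ZMod 167 → ℤ` invariant under `x ↦ 4x`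
(supports AND signs) are constant on the three classes `{0}`, `Q`, `N = -Q` (`|Q| = |N| = 83`, kernel: `decide`), so
every row sum is `t_k(0) + 83 (t_k(1) + t_k(-1))`; with the periodic grammar `Σ_k S_k² = 167` and `Σ_k t_k(0)² = 1`
this is impossible (`83·(non-zero) ± 1` squared exceeds `167`; all-zero multiples give `1 ≠ 167`):
**`no_qrInvariant_tMatrixRows_167`**.  Together with `no_symmetric_tMatrixRows_167`: **no circulant T-matrices of order
167 admit any non-trivial multiplier** (`tMatrixRows_167_no_multiplier_structure`) — the cyclotomic sub-families of the
T-matrix route to `H(668)` are certified empty; unstructured T-matrices / T-sequences of length `167` remain OPEN.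
Ours, elementary; no order excluded; H(668) untouched; HITS 0.  No `sorry` (`decide +kernel` for the class facts).
-/

open Finset BigOperators

namespace Summit.Ventures.DiscreteObjects.Hadamard

open Literature.Combinatorics.Designs.TSequences
open Literature.Combinatorics.Designs.TMatrices

/-- the quadratic residues mod `167` as the orbit of `1` under `x ↦ 4x` (`4 = 2²` has order `83`). -/
def qr167 : Finset (ZMod 167) := Finset.image (fun j : Fin 83 => (4 : ZMod 167) ^ (j : ℕ)) univ

/-- the non-residues mod `167` as the orbit of `-1` under `x ↦ 4x` (`167 ≡ 3 (mod 4)`, so `-1` is a non-residue). -/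
def nqr167 : Finset (ZMod 167) := Finset.image (fun j : Fin 83 => -(4 : ZMod 167) ^ (j : ℕ)) univ

/-- class sizes: `|Q| = |N| = 83` (kernel evaluation). -/
theorem card_qr167 : qr167.card = 83 ∧ nqr167.card = 83 := by
  constructor <;> decide +kernel

/-- the three classes `{0}`, `Q`, `N` partition `ZMod 167` (kernel evaluation). -/
theorem classes_partition_167 :
    (univ : Finset (ZMod 167)) = insert 0 (qr167 ∪ nqr167) ∧ Disjoint qr167 nqr167 ∧
      (0 : ZMod 167) ∉ qr167 ∪ nqr167 := by
  refine ⟨?_, ?_, ?_⟩ <;> decide +kernel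

/-- a function invariant under `x ↦ 4x` is constant on the orbit of any point: `f (4^j · a) = f a`. -/
lemma invariant_pow_mul {f : ZMod 167 → ℤ} (hf : ∀ x, f (4 * x) = f x) (a : ZMod 167) :
    ∀ j : ℕ, f (4 ^ j * a) = f a
  | 0 => by simp
  | j + 1 => by rw [pow_succ, mul_comm (4 ^ j : ZMod 167) 4, mul_assoc, hf, invariant_pow_mul hf a j]

/-- **sum of a QR-invariant function**: `Σ_x f(x) = f(0) + 83 f(1) + 83 f(-1)`. -/
theorem sum_qrInvariant {f : ZMod 167 → ℤ} (hf : ∀ x, f (4 * x) = f x) :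
    ∑ x, f x = f 0 + 83 * f 1 + 83 * f (-1) := by
  obtain ⟨huniv, hdisj, h0⟩ := classes_partition_167
  rw [huniv, Finset.sum_insert h0, Finset.sum_union hdisj]
  have hQ : ∑ x ∈ qr167, f x = 83 * f 1 := by
    rw [Finset.sum_congr rfl (g := fun _ => f 1) ?_, Finset.sum_const, card_qr167.1]
    · simp
    · intro x hx
      obtain ⟨j, -, rfl⟩ := Finset.mem_image.mp hx
      have := invariant_pow_mul hf 1 j
      rwa [mul_one] at this
  have hN : ∑ x ∈ nqr167, f x = 83 * f (-1) := by
    rw [Finset.sum_congr rfl (g := fun _ => f (-1)) ?_, Finset.sum_const, card_qr167.2]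
    · simp
    · intro x hx
      obtain ⟨j, -, rfl⟩ := Finset.mem_image.mp hx
      have := invariant_pow_mul hf (-1) j
      rwa [mul_neg_one] at this
  rw [hQ, hN]
  ring

/-- entries of T-matrix rows are `0` or `±1`. -/
lemma tmatrixRows_entry {n : ℕ} [NeZero n] {t : Fin 4 → ZMod n → ℤ} (ht : IsTMatrixRows n t) (k : Fin 4) (x : ZMod n) :
    t k x = 0 ∨ t k x = 1 ∨ t k x = -1 := by
  obtain ⟨k₀, hk₀, h0⟩ := ht.1 x
  by_cases hk : k = k₀
  · subst hk
    exact Or.inr hk₀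
  · exact Or.inl (h0 k hk)

/-- the arithmetic core: `(e + 83 c)² ≤ 167` with `|e| ≤ 1` forces `c = 0`. -/
lemma mult83_zero {e c : ℤ} (he : e = 0 ∨ e = 1 ∨ e = -1) (h : (e + 83 * c) ^ 2 ≤ 167) : c = 0 := by
  generalize hX : e + 83 * c = X at h
  rcases lt_trichotomy c 0 with hc | hc | hc
  · have hle : X ≤ -82 := by rcases he with rfl | rfl | rfl <;> omega
    nlinarith [hle, h]
  · exact hc
  · have hge : 82 ≤ X := by rcases he with rfl | rfl | rfl <;> omega
    nlinarith [hge, h]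

/-- **no QR-invariant circulant T-matrices of order 167**: first rows invariant under the multiplier `4` (a generator of
the quadratic residues), `t_k(4x) = t_k(x)` for all `k, x`, cannot satisfy the T-matrix conditions. -/
theorem no_qrInvariant_tMatrixRows_167 :
    ¬ ∃ t : Fin 4 → ZMod 167 → ℤ, IsTMatrixRows 167 t ∧ ∀ k x, t k (4 * x) = t k x := by
  rintro ⟨t, ht, hinv⟩
  have hgram := tmatrixRows_sum_sq ht
  have hentry := tmatrixRows_sum_sq_entry ht 0
  rw [Fin.sum_univ_four] at hgram hentry
  rw [sum_qrInvariant (hinv 0), sum_qrInvariant (hinv 1), sum_qrInvariant (hinv 2), sum_qrInvariant (hinv 3)] at hgram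
  push_cast at hgram
  -- the same identity with the row sums written as t_k(0) + 83·c_k
  have hg : (t 0 0 + 83 * (t 0 1 + t 0 (-1))) ^ 2 + (t 1 0 + 83 * (t 1 1 + t 1 (-1))) ^ 2 +
      (t 2 0 + 83 * (t 2 1 + t 2 (-1))) ^ 2 + (t 3 0 + 83 * (t 3 1 + t 3 (-1))) ^ 2 = 167 := by
    linear_combination hgram
  have n0 := sq_nonneg (t 0 0 + 83 * (t 0 1 + t 0 (-1)))
  have n1 := sq_nonneg (t 1 0 + 83 * (t 1 1 + t 1 (-1)))
  have n2 := sq_nonneg (t 2 0 + 83 * (t 2 1 + t 2 (-1)))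
  have n3 := sq_nonneg (t 3 0 + 83 * (t 3 1 + t 3 (-1)))
  have c0 := mult83_zero (c := t 0 1 + t 0 (-1)) (tmatrixRows_entry ht 0 0) (by linarith)
  have c1 := mult83_zero (c := t 1 1 + t 1 (-1)) (tmatrixRows_entry ht 1 0) (by linarith)
  have c2 := mult83_zero (c := t 2 1 + t 2 (-1)) (tmatrixRows_entry ht 2 0) (by linarith)
  have c3 := mult83_zero (c := t 3 1 + t 3 (-1)) (tmatrixRows_entry ht 3 0) (by linarith)
  rw [c0, c1, c2, c3] at hg
  -- now hg reads Σ t_k(0)² = 167, while Σ t_k(0)² = 1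
  have h1 : t 0 0 ^ 2 + t 1 0 ^ 2 + t 2 0 ^ 2 + t 3 0 ^ 2 = 1 := by linear_combination hentry
  have h2 : t 0 0 ^ 2 + t 1 0 ^ 2 + t 2 0 ^ 2 + t 3 0 ^ 2 = 167 := by linear_combination hg
  linarith

/-- **no non-trivial multiplier structure for circulant T-matrices of order 167**: invariance of the four first rows
under `x ↦ -x` (index `83`) or under `x ↦ 4x` (index `2`) — the only proper non-trivial subgroups of `(ℤ/167)ˣ` — is
impossible (kernel: `no_symmetric_tMatrixRows_167`, `no_qrInvariant_tMatrixRows_167`). -/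
theorem tMatrixRows_167_no_multiplier_structure :
    (¬ ∃ t : Fin 4 → ZMod 167 → ℤ, IsTMatrixRows 167 t ∧ ∀ k x, t k (-x) = t k x) ∧
    (¬ ∃ t : Fin 4 → ZMod 167 → ℤ, IsTMatrixRows 167 t ∧ ∀ k x, t k (4 * x) = t k x) :=
  ⟨no_symmetric_tMatrixRows_167, no_qrInvariant_tMatrixRows_167⟩

end Summit.Ventures.DiscreteObjects.Hadamard
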